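import Literature.NumberTheory.EllipticCurves.Kato2004.IwasawaInvolutionTwistProofs
import Literature.NumberTheory.EllipticCurves.Kato2004.ZetaIndexInequalityExceptionalPrimeProofs
import Literature.NumberTheory.EllipticCurves.SkinnerUrban2014.CharacteristicIdealBaseChangeProofs
import Literature.NumberTheory.EllipticCurves.IwasawaAlgebraRankOneIdealProofs
import Literature.NumberTheory.EllipticCurves.CyclotomicIwasawaMainTheoremIrreducibleProofs
import HarnessLib

/-!
# Kato 2004, Conj. 12.10 AT the one exceptional prime of (12.5.1), from Kato's own bound at the
# `ι`-CONJUGATE prime: transport of height-one lengths under the Iwasawa involution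
# (Greenberg LNM 1716 Thm. 1.14: `ι(char X) = char X`) and under the functional equation
# (`(ι L) = (L)`), PROVED as module theory over `Λ = ℤ_p⟦T⟧` (companion of
# `ZetaIndexInequalityExceptionalPrimeProofs` and `MainConjectureSkeletonProofs`)

K. Kato, *`p`-adic Hodge theory and values of zeta functions of modular forms*, Astérisque **295** (2004)
[Kato2004Asterisque]. Thm. 12.5 (3) (p. 222) bounds `length_{Λ_𝔭}(𝐇²_𝔭)` by
`length_{Λ_𝔭}(𝐇¹_𝔭/Z_𝔭) + length_{Λ_𝔭}(𝐇²_loc,𝔭)`, and the local term is non-zero (of length `1`) only at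
the ONE height-one prime `𝔮₀` of (12.5.1); Conj. 12.10 (p. 224) is the equality WITHOUT the local term at
every height-one `𝔭 ∌ p`, `𝔮₀` included. The companion file `ZetaIndexInequalityExceptionalPrimeProofs`
records what the descent §14.14 gives when `𝔮₀` carries a defect `d` (a factor `p^{d·v_p(q_{𝔮₀}(0))}`),
and §17.13's identity at `𝔮₀` (`lengthAt_add_eq_of_skeleton_exceptional`: the local term and the Coleman
colength cancel, so `ℓ(X) + ℓ(H/Z) = ℓ(Λ/(G)) + ℓ(H2)` at `𝔮₀` as at any other prime).

This file records, as pure module theory (Kato's objects are VARIABLES; nothing about them is defined or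
asserted here), that Conj. 12.10's INEQUALITY at `𝔮₀` FOLLOWS from Kato's printed bound at the conjugate
prime `ι𝔮₀` (`ι : γ ↦ γ⁻¹`, `T ↦ (1+T)⁻¹ − 1`, the tree's `IwasawaAlgebra.invol`), where there is no
local term, as soon as the two outer terms of §17.13's identity have `ι`-symmetric lengths:

* `ℓ_{𝔮₀}(X) = ℓ_{ι𝔮₀}(X)` — for `X` the dual Selmer group this is Greenberg's theorem «the characteristic
  ideal of `X_E(F_∞)` is fixed by `ι`» (R. Greenberg, LNM 1716 (1999) Thm. 1.14, proof [Gr2] = Adv. Stud.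
  Pure Math. 17 (1989) Thm. 2; tree facts `Greenberg1999_thm114_charIdeal_iota_invariant`,
  `Greenberg1999.thm114_charIdeal_iota_invariant_splitMult_baseChange`, ideal form
  `Greenberg1999.map_invol_charIdeal_eq_of_thm114`) read PRIME BY PRIME — §1 of this file,
  `lengthAt_eq_comap_invol_of_map_invol_charIdeal_eq`: a finitely generated torsion `Λ`-module whose
  characteristic ideal is `ι`-stable has the same length at `𝔓` and at `ι𝔓` (the characteristic ideal
  and the height-one lengths determine each other over the UFD `Λ`, `SkinnerUrban2014.lengthAt_eq_of_charIdeal_eq`;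
  transport along the `ι`-semilinear self-equivalence of `Λ/(f)`, `Kato2004.lengthAt_eq_of_involSemilinear`);
* `ℓ_{𝔮₀}(Λ/(G)) = ℓ_{ι𝔮₀}(Λ/(G))` — for `G` the `p`-adic `L`-function this is the functional equation
  `ι G = u·G`, `u ∈ Λˣ` (B. Mazur, J. Tate, J. Teitelbaum, Invent. Math. 84 (1986) §I.17; tree
  `padicLFunction_functional_equation`) — §1, `lengthAt_quotient_span_eq_comap_invol_of_invol_eq_unit_mul`.

§2 is the bookkeeping (`lengthAt_X_le_of_transport`, `lengthAt_H2_le_of_transport_exceptional`): from the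
§17.13 identities at `𝔮₀` (exceptional shape) and at `𝔮₀' = ι𝔮₀` (ordinary shape), Kato's Thm. 12.5 (3)
at `𝔮₀'` (no local term) and the two symmetries, `ℓ_{𝔮₀}(X) ≤ ℓ_{𝔮₀}(Λ/(G))` (Conj. 17.6's inequality at
`𝔮₀`) and `ℓ_{𝔮₀}(H2) ≤ ℓ_{𝔮₀}(H/Z)` (Conj. 12.10's inequality at `𝔮₀`). §3 feeds the latter into the
companion file's `d = 0` descent: `natCard_coinvariants_le_index_zeta_of_transport` — Thm. 14.5 (3)'s
`#(H2/TH2) ≤ [A : Λ·ι z̄]` with NO extra factor although Thm. 12.5 (3) was used with its local term at `𝔮₀`.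
§4 gives the structural forms over `Λ` (the symmetries derived from `ι(char X) = char X` and `(ι G) = (G)`).

Motivation (cell `bsd-2adic`, seat `addL2x` GEN 16, crux stmt-BirchSwinnertonDyer-19098, repair-census
R-B78; record only): for `E/ℚ` ADDITIVE at `2` whose twist by `−1` (resp. `−2`) is split multiplicative at
`2`, Kato's local term sits at `𝔮₀ = (γ − κ(γ)⁻¹) = (T + 4/5)` (resp. `(T + 6/5)`) of the odd branch; its
conjugate `ι𝔮₀ = (γ − κ(γ))` carries none, so the `+2` / `+1` of the seat's readings T17/T18 disappears once
the two symmetries are supplied (Greenberg 1.14 over `ℚ` and over `ℚ(i)` / `ℚ(√−2)` for the twist;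
MTT §I.17 for the odd branch of its `2`-adic `L`-function). That use is NOT part of this file.

THEOREMS ONLY: no definition, no named fact, no instance, no `sorry`.

References: [Kato2004Asterisque] Thm. 12.5 (3)(4) and (12.5.1) (p. 222), Conj. 12.10 (p. 224), Thm. 14.5 (3)
(p. 236), §14.14 (p. 243), Conj. 17.6 (p. 274), §17.13 (p. 280); [GreenbergLNM1716] Thm. 1.14 (p. 68) and
§1 p. 60 (`S^ι`); [Greenberg1989] Thm. 2; [MazurTateTeitelbaum1986Invent] §I.17; [Washington1997] §13.2;
[SkinnerUrban2014] §3.1.6.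
-/

noncomputable section

open scoped Classical

universe u

namespace Literature.NumberTheory.EllipticCurves.Kato2004

open Literature.NumberTheory.EllipticCurves.IwasawaAlgebra Literature.NumberTheory.EllipticCurves.Module

/-! ### §1 `ι`-symmetry of height-one lengths -/

section Symmetry

variable {p : ℕ} [Fact p.Prime]

/-- **`ℓ_𝔓(Λ/(G)) = ℓ_{ι𝔓}(Λ/(G))` when the ideal `(G)` is `ι`-stable** (`(ι G) = (G)`): the involution
induces an `ι`-semilinear additive self-equivalence of `Λ/(G)` (`Ideal.quotientEquiv`), and local lengths are
transported along it (`lengthAt_eq_of_involSemilinear`). With `G = L_{p-adic}` this is the functional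
equation read prime by prime. [cite: MazurTateTeitelbaum1986Invent, §I.17] [cite: Washington1997, §13.2] -/
theorem lengthAt_quotient_span_eq_comap_invol_of_map_invol_span_eq {G : IwasawaAlgebra p}
    (hG : (Ideal.span {G}).map (invol p).toRingHom = Ideal.span {G})
    (𝔓 : PrimeSpectrum (IwasawaAlgebra p)) :
    lengthAt (IwasawaAlgebra p) (IwasawaAlgebra p ⧸ Ideal.span {G}) 𝔓 =
      lengthAt (IwasawaAlgebra p) (IwasawaAlgebra p ⧸ Ideal.span {G})
        (PrimeSpectrum.comap (invol p).toRingHom 𝔓) := by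
  have hIJ : Ideal.span {G} =
      (Ideal.span {G}).map ((involEquiv p : IwasawaAlgebra p ≃+* IwasawaAlgebra p) :
        IwasawaAlgebra p →+* IwasawaAlgebra p) := by
    conv_lhs => rw [← hG]
    rfl
  let e : (IwasawaAlgebra p ⧸ Ideal.span {G}) ≃+* (IwasawaAlgebra p ⧸ Ideal.span {G}) :=
    Ideal.quotientEquiv (Ideal.span {G}) (Ideal.span {G})
      (involEquiv p : IwasawaAlgebra p ≃+* IwasawaAlgebra p) hIJ
  have he : ∀ (f : IwasawaAlgebra p) (m : IwasawaAlgebra p ⧸ Ideal.span {G}),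
      e.toAddEquiv (f • m) = invol p f • e.toAddEquiv m := by
    intro f m
    obtain ⟨x, rfl⟩ := Ideal.Quotient.mk_surjective m
    change e (f • Ideal.Quotient.mk _ x) = invol p f • e (Ideal.Quotient.mk _ x)
    have hsm : ∀ (g y : IwasawaAlgebra p),
        g • Ideal.Quotient.mk (Ideal.span {G}) y = Ideal.Quotient.mk (Ideal.span {G}) (g * y) :=
      fun _ _ => rfl
    rw [hsm]
    have h1 : e (Ideal.Quotient.mk (Ideal.span {G}) (f * x)) =
        Ideal.Quotient.mk (Ideal.span {G}) (invol p (f * x)) := by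
      simp only [e, Ideal.quotientEquiv_mk]
      rfl
    have h2 : e (Ideal.Quotient.mk (Ideal.span {G}) x) =
        Ideal.Quotient.mk (Ideal.span {G}) (invol p x) := by
      simp only [e, Ideal.quotientEquiv_mk]
      rfl
    rw [h1, h2, map_mul, map_mul, hsm, map_mul]
  exact lengthAt_eq_of_involSemilinear e.toAddEquiv he 𝔓

/-- **`ℓ_𝔓(Λ/(G)) = ℓ_{ι𝔓}(Λ/(G))` from the functional equation in GENERATOR form `ι G = u·G`,
`u ∈ Λˣ`** (the currency of the tree's `padicLFunction_functional_equation` /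
`Greenberg1999_thm114_charIdeal_iota_invariant`). [cite: MazurTateTeitelbaum1986Invent, §I.17] [cite: Washington1997, §13.2] -/
theorem lengthAt_quotient_span_eq_comap_invol_of_invol_eq_unit_mul {G : IwasawaAlgebra p}
    {u : (IwasawaAlgebra p)ˣ} (hG : invol p G = (u : IwasawaAlgebra p) * G)
    (𝔓 : PrimeSpectrum (IwasawaAlgebra p)) :
    lengthAt (IwasawaAlgebra p) (IwasawaAlgebra p ⧸ Ideal.span {G}) 𝔓 =
      lengthAt (IwasawaAlgebra p) (IwasawaAlgebra p ⧸ Ideal.span {G})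
        (PrimeSpectrum.comap (invol p).toRingHom 𝔓) := by
  refine lengthAt_quotient_span_eq_comap_invol_of_map_invol_span_eq ?_ 𝔓
  rw [Ideal.map_span, Set.image_singleton]
  change Ideal.span {invol p G} = Ideal.span {G}
  rw [hG]
  exact Ideal.span_singleton_mul_left_unit u.isUnit G

variable {M : Type*} [AddCommGroup M] [Module (IwasawaAlgebra p) M]

/-- **Greenberg's Thm. 1.14 read prime by prime: `ι(char X) = char X ⟹ ℓ_𝔓(X) = ℓ_{ι𝔓}(X)` at every
height-one `𝔓`**, for a finitely generated torsion `Λ`-module `X`. Proof: `char X = (f)` is principal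
(`charIdeal_isPrincipal_holds`, `Λ` a UFD) and non-zero; `X` and `Λ/(f)` have the same characteristic ideal
(`charIdeal_quotient_span_singleton`), hence the same height-one lengths (`SkinnerUrban2014.lengthAt_eq_of_charIdeal_eq`,
at `𝔓` and at `ι𝔓`, which has height one: `height_comap_invol`); and `(f)` is `ι`-stable, so
`ℓ_𝔓(Λ/(f)) = ℓ_{ι𝔓}(Λ/(f))` by the previous lemma.
[cite: GreenbergLNM1716, Thm. 1.14 (p. 68) and §1 p. 60] [cite: SkinnerUrban2014, §3.1.6 (p. 20)] [cite: Washington1997, §13.2] -/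
theorem lengthAt_eq_comap_invol_of_map_invol_charIdeal_eq [Module.Finite (IwasawaAlgebra p) M]
    (hM : Module.IsTorsion (IwasawaAlgebra p) M)
    (hι : (charIdeal (IwasawaAlgebra p) M).map (invol p).toRingHom = charIdeal (IwasawaAlgebra p) M)
    (𝔓 : PrimeSpectrum (IwasawaAlgebra p)) (h𝔓 : 𝔓.asIdeal.height = 1) :
    lengthAt (IwasawaAlgebra p) M 𝔓 =
      lengthAt (IwasawaAlgebra p) M (PrimeSpectrum.comap (invol p).toRingHom 𝔓) := by
  haveI : (charIdeal (IwasawaAlgebra p) M).IsPrincipal := charIdeal_isPrincipal_holds p M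
  set f : IwasawaAlgebra p := Submodule.IsPrincipal.generator (charIdeal (IwasawaAlgebra p) M) with hfdef
  have hf' : charIdeal (IwasawaAlgebra p) M = Ideal.span {f} :=
    (Ideal.span_singleton_generator (charIdeal (IwasawaAlgebra p) M)).symm
  have hf0 : f ≠ 0 := by
    intro h0
    apply Module.charIdeal_ne_bot (IwasawaAlgebra p) M
    rw [hf', h0, Ideal.span_singleton_eq_bot]
  have hQtors : Module.IsTorsion (IwasawaAlgebra p) (IwasawaAlgebra p ⧸ Ideal.span {f}) :=
    Module.isTorsion_quotient_of_ne_zero_mem hf0 (Ideal.subset_span (Set.mem_singleton f))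
  have hcharQ : charIdeal (IwasawaAlgebra p) (IwasawaAlgebra p ⧸ Ideal.span {f}) =
      charIdeal (IwasawaAlgebra p) M := by
    rw [Module.charIdeal_quotient_span_singleton hf0, hf']
  have h𝔓' : (PrimeSpectrum.comap (invol p).toRingHom 𝔓).asIdeal.height = 1 := by
    rw [height_comap_invol]; exact h𝔓
  have h1 := SkinnerUrban2014.lengthAt_eq_of_charIdeal_eq hQtors hM hcharQ 𝔓 h𝔓
  have h2 := SkinnerUrban2014.lengthAt_eq_of_charIdeal_eq hQtors hM hcharQ _ h𝔓'
  rw [← h1, ← h2]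
  refine lengthAt_quotient_span_eq_comap_invol_of_map_invol_span_eq ?_ 𝔓
  rw [← hf', hι]

end Symmetry

/-! ### §2 The bookkeeping: Conj. 17.6 / Conj. 12.10 at the exceptional prime by transport -/

section Transport

variable {R : Type*} [CommRing R]
  {H P X H2 H2loc : Type*} [AddCommGroup H] [_root_.Module R H] [AddCommGroup P]
  [_root_.Module R P] [AddCommGroup X] [_root_.Module R X] [AddCommGroup H2] [_root_.Module R H2]
  [AddCommGroup H2loc] [_root_.Module R H2loc]

/-- **Kato's Thm. 12.5 (3) at a prime WITHOUT local term gives Thm. 17.4 (2)'s inequality there: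
`ℓ(X)_{𝔭'} ≤ ℓ(R/(G))_{𝔭'}`.** Situation of `lengthAt_add_eq_of_skeleton` at `𝔭'`
(`H →loc P →toX X →δ H2 →ε H2loc` exact at `P, X, H2`; `loc`, `col : P → R` injective; `Z ≤ H`; AT `𝔭'`:
`ℓ(R/col P) = 0`, `ℓ(H2loc) = 0`, `ℓ(R/col(loc Z)) = ℓ(R/(G))`, `ℓ(H/Z)` finite) plus the printed bound
`ℓ(H2)_{𝔭'} ≤ ℓ(H/Z)_{𝔭'}` (Thm. 12.5 (3): the local term vanishes off the prime of (12.5.1)).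
[cite: Kato2004Asterisque, Thm. 12.5 (3)(4) (p. 222), Thm. 17.4 (2) (p. 273), §17.13 (p. 280)] -/
theorem lengthAt_X_le_of_skeleton_clean (loc : H →ₗ[R] P) (hinj : Function.Injective loc)
    (toX : P →ₗ[R] X) (δ : X →ₗ[R] H2) (ε : H2 →ₗ[R] H2loc)
    (hPX : Function.Exact loc toX) (hXH : Function.Exact toX δ) (hHE : Function.Exact δ ε)
    (col : P →ₗ[R] R) (hcol : Function.Injective col) (Z : Submodule R H) {G : R}
    (𝔭' : PrimeSpectrum R) (hcoker' : lengthAt R (R ⧸ LinearMap.range col) 𝔭' = 0)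
    (hloc2' : lengthAt R H2loc 𝔭' = 0)
    (hIG' : lengthAt R (R ⧸ (Z.map loc).map col) 𝔭' = lengthAt R (R ⧸ Ideal.span {G}) 𝔭')
    (hfinZ' : lengthAt R (H ⧸ Z) 𝔭' ≠ ⊤)
    (h125' : lengthAt R H2 𝔭' ≤ lengthAt R (H ⧸ Z) 𝔭') :
    lengthAt R X 𝔭' ≤ lengthAt R (R ⧸ Ideal.span {G}) 𝔭' := by
  have h := lengthAt_add_eq_of_skeleton loc hinj toX δ ε hPX hXH hHE col hcol Z 𝔭' hcoker' hloc2' hIG'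
  have h2 : lengthAt R X 𝔭' + lengthAt R (H ⧸ Z) 𝔭' ≤
      lengthAt R (R ⧸ Ideal.span {G}) 𝔭' + lengthAt R (H ⧸ Z) 𝔭' := by
    rw [h]
    gcongr
  exact (WithTop.add_le_add_iff_right hfinZ').mp h2

/-- **TRANSPORT, Conj. 17.6's inequality at the exceptional prime: `ℓ(X)_𝔭 ≤ ℓ(R/(G))_𝔭`.** If the
outer lengths are symmetric between `𝔭` and `𝔭'` — `ℓ(X)_𝔭 = ℓ(X)_{𝔭'}` (Greenberg's `ι`-invariance of
`char X`, §1) and `ℓ(R/(G))_𝔭 = ℓ(R/(G))_{𝔭'}` (functional equation of `G`, §1) — then Kato's bound at the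
clean prime `𝔭'` (`lengthAt_X_le_of_skeleton_clean`) IS the bound at `𝔭`. Pure bookkeeping; with `𝔭` the
prime of (12.5.1) and `𝔭' = ι𝔭` this removes the local term of Thm. 12.5 (3) from the Selmer side.
[cite: Kato2004Asterisque, Thm. 12.5 (3) and (12.5.1) (p. 222), Conj. 17.6 (p. 274), §17.13 (p. 280)]
[cite: GreenbergLNM1716, Thm. 1.14 (p. 68)] [cite: MazurTateTeitelbaum1986Invent, §I.17] -/
theorem lengthAt_X_le_of_transport (loc : H →ₗ[R] P) (hinj : Function.Injective loc)
    (toX : P →ₗ[R] X) (δ : X →ₗ[R] H2) (ε : H2 →ₗ[R] H2loc)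
    (hPX : Function.Exact loc toX) (hXH : Function.Exact toX δ) (hHE : Function.Exact δ ε)
    (col : P →ₗ[R] R) (hcol : Function.Injective col) (Z : Submodule R H) {G : R}
    (𝔭 𝔭' : PrimeSpectrum R) (hcoker' : lengthAt R (R ⧸ LinearMap.range col) 𝔭' = 0)
    (hloc2' : lengthAt R H2loc 𝔭' = 0)
    (hIG' : lengthAt R (R ⧸ (Z.map loc).map col) 𝔭' = lengthAt R (R ⧸ Ideal.span {G}) 𝔭')
    (hfinZ' : lengthAt R (H ⧸ Z) 𝔭' ≠ ⊤)
    (h125' : lengthAt R H2 𝔭' ≤ lengthAt R (H ⧸ Z) 𝔭')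
    (hX : lengthAt R X 𝔭 = lengthAt R X 𝔭')
    (hG : lengthAt R (R ⧸ Ideal.span {G}) 𝔭 = lengthAt R (R ⧸ Ideal.span {G}) 𝔭') :
    lengthAt R X 𝔭 ≤ lengthAt R (R ⧸ Ideal.span {G}) 𝔭 := by
  rw [hX, hG]
  exact lengthAt_X_le_of_skeleton_clean loc hinj toX δ ε hPX hXH hHE col hcol Z 𝔭' hcoker' hloc2' hIG'
    hfinZ' h125'

/-- **TRANSPORT, Conj. 12.10's inequality AT the exceptional prime: `ℓ(H2)_𝔭 ≤ ℓ(H/Z)_𝔭`.** At `𝔭` the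
skeleton has the exceptional shape of `lengthAt_add_eq_of_skeleton_exceptional` (local term
`ℓ(ε H2)_𝔭 = e`, Coleman excess `ℓ(R/col(loc Z))_𝔭 = ℓ(R/(G))_𝔭 + e`, `ℓ(R/col P)_𝔭 = 0`; `ℓ(R/(G))_𝔭`
finite), at `𝔭'` the ordinary shape with Kato's printed bound `ℓ(H2)_{𝔭'} ≤ ℓ(H/Z)_{𝔭'}`, and the outer
lengths are symmetric (`ℓ(X)_𝔭 = ℓ(X)_{𝔭'}`, `ℓ(R/(G))_𝔭 = ℓ(R/(G))_{𝔭'}`). Then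
`ℓ(R/(G))_𝔭 + ℓ(H2)_𝔭 = ℓ(X)_𝔭 + ℓ(H/Z)_𝔭 ≤ ℓ(R/(G))_𝔭 + ℓ(H/Z)_𝔭`. So Kato's printed Thm. 12.5 (3)
(with its local term at `𝔭`, none at `𝔭'`) and the two symmetries give Conj. 12.10's inequality at `𝔭`
— the ONE prime where Thm. 12.5 (4) does not print it.
[cite: Kato2004Asterisque, Thm. 12.5 (3)(4) and (12.5.1) (p. 222), Conj. 12.10 (p. 224), §17.13 (p. 280)]
[cite: GreenbergLNM1716, Thm. 1.14 (p. 68)] [cite: MazurTateTeitelbaum1986Invent, §I.17] -/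
theorem lengthAt_H2_le_of_transport_exceptional (loc : H →ₗ[R] P) (hinj : Function.Injective loc)
    (toX : P →ₗ[R] X) (δ : X →ₗ[R] H2) (ε : H2 →ₗ[R] H2loc)
    (hPX : Function.Exact loc toX) (hXH : Function.Exact toX δ) (hHE : Function.Exact δ ε)
    (col : P →ₗ[R] R) (hcol : Function.Injective col) (Z : Submodule R H) {G : R}
    (𝔭 𝔭' : PrimeSpectrum R) (e : ℕ)
    (hcoker : lengthAt R (R ⧸ LinearMap.range col) 𝔭 = 0)
    (hloc2 : lengthAt R (LinearMap.range ε) 𝔭 = e)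
    (hIG : lengthAt R (R ⧸ (Z.map loc).map col) 𝔭 = lengthAt R (R ⧸ Ideal.span {G}) 𝔭 + e)
    (hfinG : lengthAt R (R ⧸ Ideal.span {G}) 𝔭 ≠ ⊤)
    (hcoker' : lengthAt R (R ⧸ LinearMap.range col) 𝔭' = 0)
    (hloc2' : lengthAt R H2loc 𝔭' = 0)
    (hIG' : lengthAt R (R ⧸ (Z.map loc).map col) 𝔭' = lengthAt R (R ⧸ Ideal.span {G}) 𝔭')
    (hfinZ' : lengthAt R (H ⧸ Z) 𝔭' ≠ ⊤)
    (h125' : lengthAt R H2 𝔭' ≤ lengthAt R (H ⧸ Z) 𝔭')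
    (hX : lengthAt R X 𝔭 = lengthAt R X 𝔭')
    (hG : lengthAt R (R ⧸ Ideal.span {G}) 𝔭 = lengthAt R (R ⧸ Ideal.span {G}) 𝔭') :
    lengthAt R H2 𝔭 ≤ lengthAt R (H ⧸ Z) 𝔭 := by
  have hXG : lengthAt R X 𝔭 ≤ lengthAt R (R ⧸ Ideal.span {G}) 𝔭 :=
    lengthAt_X_le_of_transport loc hinj toX δ ε hPX hXH hHE col hcol Z 𝔭 𝔭' hcoker' hloc2' hIG' hfinZ'
      h125' hX hG
  have h := lengthAt_add_eq_of_skeleton_exceptional loc hinj toX δ ε hPX hXH hHE col hcol Z 𝔭 e hcoker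
    hloc2 hIG
  have h2 : lengthAt R (R ⧸ Ideal.span {G}) 𝔭 + lengthAt R H2 𝔭 ≤
      lengthAt R (R ⧸ Ideal.span {G}) 𝔭 + lengthAt R (H ⧸ Z) 𝔭 := by
    rw [← h]
    gcongr
  exact (WithTop.add_le_add_iff_left hfinG).mp h2

end Transport

/-! ### §3 Into the descent: Thm. 14.5 (3) with NO extra factor -/

section Descent

variable {p : ℕ} [Fact p.Prime]
  {H P X H2 H2loc A : Type u} [AddCommGroup H] [Module (IwasawaAlgebra p) H]
  [AddCommGroup P] [Module (IwasawaAlgebra p) P] [AddCommGroup X] [Module (IwasawaAlgebra p) X]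
  [AddCommGroup H2] [Module (IwasawaAlgebra p) H2] [AddCommGroup H2loc] [Module (IwasawaAlgebra p) H2loc]
  [AddCommGroup A] [Module (IwasawaAlgebra p) A]
  [Module.Finite (IwasawaAlgebra p) H] [NoZeroSMulDivisors (IwasawaAlgebra p) H]
  [Module.Finite (IwasawaAlgebra p) H2]

/-- **`#(H2/TH2) ≤ [A : Λ·ι z̄]` — Kato's Thm. 14.5 (3) bound `#H²(ℤ[1/p],T) ≤ [H¹(ℤ[1/p],T) : z]` with NO
extra factor — from Thm. 12.5 (3) used WITH its local term at the one exceptional prime `𝔮₀`.** Data of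
`natCard_coinvariants_le_index_zeta_of_lengthAt_le_heightOneNeT` (file `ZetaIndexInequalityExceptionalPrimeProofs`:
`H` = `𝐇¹` torsion free, `z` the zeta element, `H2` = `𝐇²` torsion, (14.14.1) `0 → H/TH →ι A →π H2[T] → 0`,
finiteness of `H2/TH2` and `(H/Λz)/T`), the divisibility `ℓ_𝔮(H2) ≤ ℓ_𝔮(H/Λz)` of Thm. 12.5 (4) at every
height-one `𝔮 ≠ (T)` OTHER than `𝔮₀`, and at `𝔮₀` the transport package of
`lengthAt_H2_le_of_transport_exceptional` (the §17.13 skeleton `H → P → X → H2 → H2loc` with `Z = Λz`;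
exceptional shape at `𝔮₀`, ordinary shape and Kato's bound at `𝔮₀'`; `ℓ(X)` and `ℓ(Λ/(G))` symmetric
between `𝔮₀` and `𝔮₀'`). Compare `natCard_coinvariants_le_pow_mul_index_zeta_of_lengthAt_le_off_prime`
(factor `p^{d·v_p(q_{𝔮₀}(0))}` without the transport).
[cite: Kato2004Asterisque, Thm. 12.5 (3)(4) and (12.5.1) (p. 222), Thm. 14.5 (3) (p. 236), §14.14 and Lemma 14.15 (pp. 243–244), §17.13 (p. 280)]
[cite: GreenbergLNM1716, Thm. 1.14 (p. 68)] -/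
theorem natCard_coinvariants_le_index_zeta_of_transport (z : H) (hz : z ≠ 0)
    (hHZ : Module.IsTorsion (IwasawaAlgebra p) (H ⧸ (IwasawaAlgebra p) ∙ z))
    (hH2 : Module.IsTorsion (IwasawaAlgebra p) H2)
    (𝔮₀ : PrimeSpectrum (IwasawaAlgebra p)) (h𝔮₀ : 𝔮₀ ∈ heightOneNeT p)
    (hdiv : ∀ 𝔮 : PrimeSpectrum (IwasawaAlgebra p), 𝔮 ∈ heightOneNeT p → 𝔮 ≠ 𝔮₀ →
      lengthAt (IwasawaAlgebra p) H2 𝔮 ≤ lengthAt (IwasawaAlgebra p) (H ⧸ (IwasawaAlgebra p) ∙ z) 𝔮)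
    (ι : coinvariants p H →ₗ[IwasawaAlgebra p] A) (π : A →ₗ[IwasawaAlgebra p] invariants p H2)
    (hι : Function.Injective ι) (hπ : Function.Surjective π) (hex : Function.Exact ι π)
    (hfin : Finite (coinvariants p H2))
    (hfinZ : Finite (coinvariants p (H ⧸ (IwasawaAlgebra p) ∙ z)))
    -- the §17.13 skeleton and the transport package at `(𝔮₀, 𝔮₀')`
    (loc : H →ₗ[IwasawaAlgebra p] P) (hinj : Function.Injective loc)
    (toX : P →ₗ[IwasawaAlgebra p] X) (δ : X →ₗ[IwasawaAlgebra p] H2)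
    (ε : H2 →ₗ[IwasawaAlgebra p] H2loc)
    (hPX : Function.Exact loc toX) (hXH : Function.Exact toX δ) (hHE : Function.Exact δ ε)
    (col : P →ₗ[IwasawaAlgebra p] IwasawaAlgebra p) (hcol : Function.Injective col)
    {G : IwasawaAlgebra p} (𝔮₀' : PrimeSpectrum (IwasawaAlgebra p)) (e : ℕ)
    (hcoker : lengthAt (IwasawaAlgebra p) (IwasawaAlgebra p ⧸ LinearMap.range col) 𝔮₀ = 0)
    (hloc2 : lengthAt (IwasawaAlgebra p) (LinearMap.range ε) 𝔮₀ = e)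
    (hIG : lengthAt (IwasawaAlgebra p)
        (IwasawaAlgebra p ⧸ (((IwasawaAlgebra p) ∙ z).map loc).map col) 𝔮₀ =
      lengthAt (IwasawaAlgebra p) (IwasawaAlgebra p ⧸ Ideal.span {G}) 𝔮₀ + e)
    (hfinG : lengthAt (IwasawaAlgebra p) (IwasawaAlgebra p ⧸ Ideal.span {G}) 𝔮₀ ≠ ⊤)
    (hcoker' : lengthAt (IwasawaAlgebra p) (IwasawaAlgebra p ⧸ LinearMap.range col) 𝔮₀' = 0)
    (hloc2' : lengthAt (IwasawaAlgebra p) H2loc 𝔮₀' = 0)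
    (hIG' : lengthAt (IwasawaAlgebra p)
        (IwasawaAlgebra p ⧸ (((IwasawaAlgebra p) ∙ z).map loc).map col) 𝔮₀' =
      lengthAt (IwasawaAlgebra p) (IwasawaAlgebra p ⧸ Ideal.span {G}) 𝔮₀')
    (hfinZ' : lengthAt (IwasawaAlgebra p) (H ⧸ (IwasawaAlgebra p) ∙ z) 𝔮₀' ≠ ⊤)
    (h125' : lengthAt (IwasawaAlgebra p) H2 𝔮₀' ≤
      lengthAt (IwasawaAlgebra p) (H ⧸ (IwasawaAlgebra p) ∙ z) 𝔮₀')
    (hX : lengthAt (IwasawaAlgebra p) X 𝔮₀ = lengthAt (IwasawaAlgebra p) X 𝔮₀')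
    (hG : lengthAt (IwasawaAlgebra p) (IwasawaAlgebra p ⧸ Ideal.span {G}) 𝔮₀ =
      lengthAt (IwasawaAlgebra p) (IwasawaAlgebra p ⧸ Ideal.span {G}) 𝔮₀') :
    Nat.card (coinvariants p H2) ≤
      Nat.card (A ⧸ (IwasawaAlgebra p) ∙ ι (Submodule.Quotient.mk z)) := by
  refine natCard_coinvariants_le_index_zeta_of_lengthAt_le_heightOneNeT z hz hHZ hH2 ?_ ι π hι hπ hex
    hfin hfinZ 𝔮₀ h𝔮₀
  intro 𝔮 h𝔮
  by_cases h𝔮₀' : 𝔮 = 𝔮₀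
  · subst h𝔮₀'
    exact lengthAt_H2_le_of_transport_exceptional loc hinj toX δ ε hPX hXH hHE col hcol
      ((IwasawaAlgebra p) ∙ z) 𝔮 𝔮₀' e hcoker hloc2 hIG hfinG hcoker' hloc2' hIG' hfinZ' h125' hX hG
  · exact hdiv 𝔮 h𝔮 h𝔮₀'

end Descent

/-! ### §4 Over `Λ`, with the symmetries supplied by `ι(char X) = char X` and `(ι G) = (G)` -/

section Structural

variable {p : ℕ} [Fact p.Prime]
  {H P X H2 H2loc : Type*} [AddCommGroup H] [Module (IwasawaAlgebra p) H]
  [AddCommGroup P] [Module (IwasawaAlgebra p) P] [AddCommGroup X] [Module (IwasawaAlgebra p) X]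
  [AddCommGroup H2] [Module (IwasawaAlgebra p) H2] [AddCommGroup H2loc] [Module (IwasawaAlgebra p) H2loc]

/-- **Conj. 12.10's inequality at the exceptional prime `𝔭` from Kato's bound at `ι𝔭`, GREENBERG'S
THEOREM `ι(char X) = char X` (LNM 1716 Thm. 1.14, ideal form) and the FUNCTIONAL EQUATION `(ι G) = (G)`
(MTT §I.17)** — the structural form of `lengthAt_H2_le_of_transport_exceptional` over `Λ = ℤ_p⟦T⟧`:
`X` finitely generated torsion with `ι`-stable characteristic ideal, `(G)` `ι`-stable, `𝔭` of height one,
`𝔭' = ι𝔭` (`PrimeSpectrum.comap (invol p)`), exceptional skeleton shape at `𝔭`, ordinary shape and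
Thm. 12.5 (3) at `ι𝔭`.
[cite: Kato2004Asterisque, Thm. 12.5 (3)(4) and (12.5.1) (p. 222), Conj. 12.10 (p. 224), §17.13 (p. 280)]
[cite: GreenbergLNM1716, Thm. 1.14 (p. 68)] [cite: MazurTateTeitelbaum1986Invent, §I.17] -/
theorem lengthAt_H2_le_of_invol_transport_exceptional [Module.Finite (IwasawaAlgebra p) X]
    (hXtors : Module.IsTorsion (IwasawaAlgebra p) X)
    (hXι : (charIdeal (IwasawaAlgebra p) X).map (invol p).toRingHom = charIdeal (IwasawaAlgebra p) X)
    (loc : H →ₗ[IwasawaAlgebra p] P) (hinj : Function.Injective loc)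
    (toX : P →ₗ[IwasawaAlgebra p] X) (δ : X →ₗ[IwasawaAlgebra p] H2)
    (ε : H2 →ₗ[IwasawaAlgebra p] H2loc)
    (hPX : Function.Exact loc toX) (hXH : Function.Exact toX δ) (hHE : Function.Exact δ ε)
    (col : P →ₗ[IwasawaAlgebra p] IwasawaAlgebra p) (hcol : Function.Injective col)
    (Z : Submodule (IwasawaAlgebra p) H) {G : IwasawaAlgebra p}
    (hGι : (Ideal.span {G}).map (invol p).toRingHom = Ideal.span {G})
    (𝔭 : PrimeSpectrum (IwasawaAlgebra p)) (h𝔭 : 𝔭.asIdeal.height = 1) (e : ℕ)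
    (hcoker : lengthAt (IwasawaAlgebra p) (IwasawaAlgebra p ⧸ LinearMap.range col) 𝔭 = 0)
    (hloc2 : lengthAt (IwasawaAlgebra p) (LinearMap.range ε) 𝔭 = e)
    (hIG : lengthAt (IwasawaAlgebra p) (IwasawaAlgebra p ⧸ (Z.map loc).map col) 𝔭 =
      lengthAt (IwasawaAlgebra p) (IwasawaAlgebra p ⧸ Ideal.span {G}) 𝔭 + e)
    (hfinG : lengthAt (IwasawaAlgebra p) (IwasawaAlgebra p ⧸ Ideal.span {G}) 𝔭 ≠ ⊤)
    (hcoker' : lengthAt (IwasawaAlgebra p) (IwasawaAlgebra p ⧸ LinearMap.range col)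
      (PrimeSpectrum.comap (invol p).toRingHom 𝔭) = 0)
    (hloc2' : lengthAt (IwasawaAlgebra p) H2loc (PrimeSpectrum.comap (invol p).toRingHom 𝔭) = 0)
    (hIG' : lengthAt (IwasawaAlgebra p) (IwasawaAlgebra p ⧸ (Z.map loc).map col)
        (PrimeSpectrum.comap (invol p).toRingHom 𝔭) =
      lengthAt (IwasawaAlgebra p) (IwasawaAlgebra p ⧸ Ideal.span {G})
        (PrimeSpectrum.comap (invol p).toRingHom 𝔭))
    (hfinZ' : lengthAt (IwasawaAlgebra p) (H ⧸ Z) (PrimeSpectrum.comap (invol p).toRingHom 𝔭) ≠ ⊤)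
    (h125' : lengthAt (IwasawaAlgebra p) H2 (PrimeSpectrum.comap (invol p).toRingHom 𝔭) ≤
      lengthAt (IwasawaAlgebra p) (H ⧸ Z) (PrimeSpectrum.comap (invol p).toRingHom 𝔭)) :
    lengthAt (IwasawaAlgebra p) H2 𝔭 ≤ lengthAt (IwasawaAlgebra p) (H ⧸ Z) 𝔭 :=
  lengthAt_H2_le_of_transport_exceptional loc hinj toX δ ε hPX hXH hHE col hcol Z 𝔭
    (PrimeSpectrum.comap (invol p).toRingHom 𝔭) e hcoker hloc2 hIG hfinG hcoker' hloc2' hIG' hfinZ' h125'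
    (lengthAt_eq_comap_invol_of_map_invol_charIdeal_eq hXtors hXι 𝔭 h𝔭)
    (lengthAt_quotient_span_eq_comap_invol_of_map_invol_span_eq hGι 𝔭)

end Structural

end Literature.NumberTheory.EllipticCurves.Kato2004

end
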